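import Summits.CriticalPhenomena.Ising3DConformalLimit.Theses.SubPtolemyInterlacing
import Summits.CriticalPhenomena.Ising3DConformalLimit.Theorems.SubPtolemyInterlacingInterlacingAxisPair
import Summits.CriticalPhenomena.Ising3DConformalLimit.Theorems.SubPtolemyInterlacingInterlacingLogConvex
import Summits.CriticalPhenomena.Ising3DConformalLimit.Theorems.SubPtolemyInterlacingInterlacingMonotone
import Summits.CriticalPhenomena.Ising3DConformalLimit.Theorems.SubPtolemyInterlacingInterlacingLebowitzRegime
import Summits.CriticalPhenomena.Ising3DConformalLimit.Theorems.SubPtolemyInterlacingInterlacingBoxLimit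
import Summits.CriticalPhenomena.Ising3DConformalLimit.Theorems.EnergyNotSigmaSquaredGapForcesFarMergingScreeningDefs
import HarnessLib

/-!
# Birth skeleton (BC3) for the crux `SubPtolemyInterlacing.Interlacing`
(item stmt-CriticalPhenomena-15702, route `SubPtolemyInterlacing`, rank 2) — line `birth`, SCREENING CURRENCY

The crux (SPC, "sub-Ptolemy / interlacing"): at `β = β_c(3)`, for all gaps `a, b, c ≥ 1` and the axis quadruple
`x₁ = 0, x₂ = a e₁, x₃ = (a+b) e₁, x₄ = (a+b+c) e₁` of `ℤ³`: `S₄ · P₂ ≤ P₁ · P₃` with the pairings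
`P₁ = G₁₂G₃₄` (adjacent), `P₂ = G₁₃G₂₄` (crossing), `P₃ = G₁₄G₂₃` (nested).

## The decomposition (two named stubs + landed tree theorems; `Interlacing_of` is a real proof)

Write, in the free box `Λ_n = box 3 n` at `β_c(3)`, `MSⁿ := meanScreening n n x₁ x₃ x₂ x₄`
`= 𝔼^{x₁x₃},∅}_{Λ_n}[𝟙[x₂,x₄ ∉ 𝒞] · ⟨σ_{x₂}σ_{x₄}⟩_{Λ_n∖𝒞} / ⟨σ_{x₂}σ_{x₄}⟩_{Λ_n}]`, `𝒞 = C_{n₁+n₂}(x₁)` the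
duplicated cluster of the INTERLACED strand `x₁ → x₃` (sources `{x₁}∆{x₃}` and `∅`), probed by the straddling pair
`(x₂, x₄)` — the MEAN SCREENING of the sibling crux `GapForcesFarMerging`'s line `screening-form-lemma-a1`
(`Theorems/EnergyNotSigmaSquaredGapForcesFarMergingScreeningDefs.lean`).

* `stub_defectIdentity` (provable now, size S/M): for `a+b+c ≤ n`, the BOX SPC DEFECT IS THE SCREENING EXCESS,
  `S₄ⁿP₂ⁿ − P₁ⁿP₃ⁿ = 2(P₂ⁿ)²·MSⁿ − (P₁ⁿ − P₂ⁿ)(P₃ⁿ − P₂ⁿ)`.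
  Route: the landed box switching identity `Sketch.stub_boxSwitching` (ADC21 (3.11): `S₄ⁿ = ΣPⁿ − 2P₂ⁿ·𝐏^{13,24}_n[x₁↔x₂]`,
  `Theorems/SubPtolemyInterlacingInterlacingBoxSwitching.lean`) and the landed screening dictionary
  `EnergyNotSigmaSquaredGapForcesFarMerging.stub_screeningIdentity` (ADC21 Lemma A.1: `MSⁿ = 1 − 𝐏^{13,24}_n[x₁↔x₂]`),
  then `ring`.
* `stub_cageScreening` (THE OPEN CONTENT, size L): outside the Lebowitz corner, eventually in `n`,
  `2(P₂ⁿ)²·MSⁿ ≤ (P₁ⁿ − P₂ⁿ)(P₃ⁿ − P₂ⁿ)`, i.e. `MS ≤ (u−1)(t−1)/2` (`u = P₁/P₂`, `t = P₃/P₂`): the duplicated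
  interlaced strand screens at least the fraction `1 − (u−1)(t−1)/2 = ι*` (≈ 0.45–0.5 at `β_c(3)`) of the straddling
  probe correlation. Modulo the landed dictionary this is EQUIVALENT to `Sketch.stub_engine` (merging form,
  `𝐏[merge] ≥ ι*`); it is the screening/"cage" currency (c) of the lead's line card, typed over tree objects that
  already carry a calculus (antitone screening ratio, explored clusters, two-strand floors of `GapForcesFarMerging`).
* `Interlacing_of : Interlacing` (crux BY NAME; real proof, the only `sorry`s are inside the two stubs; hypothesis form as a
  sorry-free `example`): per `(a,b,c)`, the Lebowitz corner `2P₂² ≤ (P₁−P₂)(P₃−P₂)` is the landed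
  `Sketch.stub_lebowitzRegime` (through the axis dictionary `Sketch.stub_axisPair`); in the window,
  `stub_cageScreening` (fed with the landed `Sketch.stub_monotone`, `Sketch.stub_logConvex`) and `stub_defectIdentity`
  give box SPC eventually in `n`, and the landed `Sketch.stub_boxLimit` passes to `Λ_n ↑ ℤ³`.

Disproof.lean honoured: no `_false_without_` obstruction exists (gap hypotheses are decoration, `interlacingAllGaps_iff`);
`stub_cageScreening` is QUANTITATIVE (a numerical screening level, not sign information: `engine_inputs_insufficient`
shows `u,t ≥ 1` + Lebowitz + GKS alone cannot give it), anti-Gaussian (`not_wickSPC_pow_one`: the Wick caricature has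
`MS`-analogue `1 > 1/2`), and keeps the interlaced slot (`not_chain_adjacentPenalised`). No stub is an instance of a
landed `Interlacing/Negative` lemma (`not_interlacing_strict_allGaps` concerns the strict all-gaps form only).
-/

noncomputable section

namespace Summit.CriticalPhenomena.Ising3DConformalLimit.Cruxes.Interlacing.Birth

open Filter MeasureTheory
open scoped symmDiff Topology
open Literature.Probability.LatticeModels Literature.Probability.Percolation
open Summit.CriticalPhenomena.Ising3DConformalLimit.Theses.SubPtolemyInterlacing (Interlacing)
open Summit.CriticalPhenomena.Ising3DConformalLimit.GapForcesFarMergingScreening (meanScreening)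
open Summit.CriticalPhenomena.Ising3DConformalLimit.Cruxes.Interlacing.Sketch
  (stub_axisPair stub_logConvex stub_monotone stub_lebowitzRegime stub_boxLimit)

/-! ### Stub 1 — the box SPC defect is the screening excess (provable now) -/

/-- **Stub `stub_defectIdentity`.** In the free box `Λ_n ∋ x₁,…,x₄` (`a+b+c ≤ n`) at `β_c(3)`:
`S₄ⁿ·P₂ⁿ − P₁ⁿ·P₃ⁿ = 2(P₂ⁿ)²·MSⁿ − (P₁ⁿ − P₂ⁿ)(P₃ⁿ − P₂ⁿ)`, `MSⁿ = meanScreening n n x₁ x₃ x₂ x₄`.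
Provable now: `Sketch.stub_boxSwitching` (landed) + `stub_screeningIdentity` (landed, with `(o,x,a,b) = (x₁,x₃,x₂,x₄)`)
+ `ring`. -/
theorem stub_defectIdentity : ∀ n a b c : ℕ, a + b + c ≤ n →
    isingExpect (zdGraph 3) (box 3 n) (criticalBeta 3) 0 .free (spinMonomial ![(Pi.single 0 ((0 : ℕ) : ℤ)), (Pi.single 0 ((a : ℕ) : ℤ)), (Pi.single 0 ((a + b : ℕ) : ℤ)), (Pi.single 0 ((a + b + c : ℕ) : ℤ))]) *
          (isingTwoPoint (zdGraph 3) (box 3 n) (criticalBeta 3) 0 .free (Pi.single 0 ((0 : ℕ) : ℤ)) (Pi.single 0 ((a + b : ℕ) : ℤ)) *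
            isingTwoPoint (zdGraph 3) (box 3 n) (criticalBeta 3) 0 .free (Pi.single 0 ((a : ℕ) : ℤ)) (Pi.single 0 ((a + b + c : ℕ) : ℤ))) -
        isingTwoPoint (zdGraph 3) (box 3 n) (criticalBeta 3) 0 .free (Pi.single 0 ((0 : ℕ) : ℤ)) (Pi.single 0 ((a : ℕ) : ℤ)) *
            isingTwoPoint (zdGraph 3) (box 3 n) (criticalBeta 3) 0 .free (Pi.single 0 ((a + b : ℕ) : ℤ)) (Pi.single 0 ((a + b + c : ℕ) : ℤ)) *
          (isingTwoPoint (zdGraph 3) (box 3 n) (criticalBeta 3) 0 .free (Pi.single 0 ((0 : ℕ) : ℤ)) (Pi.single 0 ((a + b + c : ℕ) : ℤ)) *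
            isingTwoPoint (zdGraph 3) (box 3 n) (criticalBeta 3) 0 .free (Pi.single 0 ((a : ℕ) : ℤ)) (Pi.single 0 ((a + b : ℕ) : ℤ))) =
      2 * (isingTwoPoint (zdGraph 3) (box 3 n) (criticalBeta 3) 0 .free (Pi.single 0 ((0 : ℕ) : ℤ)) (Pi.single 0 ((a + b : ℕ) : ℤ)) *
            isingTwoPoint (zdGraph 3) (box 3 n) (criticalBeta 3) 0 .free (Pi.single 0 ((a : ℕ) : ℤ)) (Pi.single 0 ((a + b + c : ℕ) : ℤ))) ^ 2 *
          meanScreening n n (Pi.single 0 ((0 : ℕ) : ℤ)) (Pi.single 0 ((a + b : ℕ) : ℤ)) (Pi.single 0 ((a : ℕ) : ℤ)) (Pi.single 0 ((a + b + c : ℕ) : ℤ)) -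
        (isingTwoPoint (zdGraph 3) (box 3 n) (criticalBeta 3) 0 .free (Pi.single 0 ((0 : ℕ) : ℤ)) (Pi.single 0 ((a : ℕ) : ℤ)) *
            isingTwoPoint (zdGraph 3) (box 3 n) (criticalBeta 3) 0 .free (Pi.single 0 ((a + b : ℕ) : ℤ)) (Pi.single 0 ((a + b + c : ℕ) : ℤ)) -
          isingTwoPoint (zdGraph 3) (box 3 n) (criticalBeta 3) 0 .free (Pi.single 0 ((0 : ℕ) : ℤ)) (Pi.single 0 ((a + b : ℕ) : ℤ)) *
            isingTwoPoint (zdGraph 3) (box 3 n) (criticalBeta 3) 0 .free (Pi.single 0 ((a : ℕ) : ℤ)) (Pi.single 0 ((a + b + c : ℕ) : ℤ))) *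
          (isingTwoPoint (zdGraph 3) (box 3 n) (criticalBeta 3) 0 .free (Pi.single 0 ((0 : ℕ) : ℤ)) (Pi.single 0 ((a + b + c : ℕ) : ℤ)) *
            isingTwoPoint (zdGraph 3) (box 3 n) (criticalBeta 3) 0 .free (Pi.single 0 ((a : ℕ) : ℤ)) (Pi.single 0 ((a + b : ℕ) : ℤ)) -
            isingTwoPoint (zdGraph 3) (box 3 n) (criticalBeta 3) 0 .free (Pi.single 0 ((0 : ℕ) : ℤ)) (Pi.single 0 ((a + b : ℕ) : ℤ)) *
            isingTwoPoint (zdGraph 3) (box 3 n) (criticalBeta 3) 0 .free (Pi.single 0 ((a : ℕ) : ℤ)) (Pi.single 0 ((a + b + c : ℕ) : ℤ))) := by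
  sorry

/-! ### Stub 2 — THE CAGE SCREENING LEVEL (the crux's open content, screening currency) -/

/-- **Stub `stub_cageScreening`.** For gaps `a, b, c ≥ 1` with the standing axis facts `P₂ ≤ P₁` (MMS),
`P₂ ≤ P₃` (RP log-convexity) and OUTSIDE the Lebowitz corner (`(P₁−P₂)(P₃−P₂) < 2P₂²`, infinite-volume values),
eventually in the box size `n`: `2(P₂ⁿ)²·MSⁿ ≤ (P₁ⁿ − P₂ⁿ)(P₃ⁿ − P₂ⁿ)` — the duplicated interlaced strand
`x₁ → x₃` screens the straddling probe pair `(x₂,x₄)` down to mean ratio `≤ (u−1)(t−1)/2`. Equivalent (landed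
dictionary) to `Sketch.stub_engine`; false for the Gaussian caricature and for `β > β_c` (Disproof.lean §C1), so the
proof must use criticality of the n.n. law on `ℤ³` quantitatively. -/
theorem stub_cageScreening : ∀ a b c : ℕ, 1 ≤ a → 1 ≤ b → 1 ≤ c →
    criticalTwoPoint 3 (Pi.single 0 ((a + b : ℕ) : ℤ)) * criticalTwoPoint 3 (Pi.single 0 ((b + c : ℕ) : ℤ)) ≤
      criticalTwoPoint 3 (Pi.single 0 ((a : ℕ) : ℤ)) * criticalTwoPoint 3 (Pi.single 0 ((c : ℕ) : ℤ)) →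
    criticalTwoPoint 3 (Pi.single 0 ((a + b : ℕ) : ℤ)) * criticalTwoPoint 3 (Pi.single 0 ((b + c : ℕ) : ℤ)) ≤
      criticalTwoPoint 3 (Pi.single 0 ((a + b + c : ℕ) : ℤ)) * criticalTwoPoint 3 (Pi.single 0 ((b : ℕ) : ℤ)) →
    (criticalTwoPoint 3 (Pi.single 0 ((a : ℕ) : ℤ)) * criticalTwoPoint 3 (Pi.single 0 ((c : ℕ) : ℤ)) -
          criticalTwoPoint 3 (Pi.single 0 ((a + b : ℕ) : ℤ)) * criticalTwoPoint 3 (Pi.single 0 ((b + c : ℕ) : ℤ))) *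
        (criticalTwoPoint 3 (Pi.single 0 ((a + b + c : ℕ) : ℤ)) * criticalTwoPoint 3 (Pi.single 0 ((b : ℕ) : ℤ)) -
          criticalTwoPoint 3 (Pi.single 0 ((a + b : ℕ) : ℤ)) * criticalTwoPoint 3 (Pi.single 0 ((b + c : ℕ) : ℤ))) <
      2 * (criticalTwoPoint 3 (Pi.single 0 ((a + b : ℕ) : ℤ)) * criticalTwoPoint 3 (Pi.single 0 ((b + c : ℕ) : ℤ))) ^ 2 →
    ∀ᶠ n : ℕ in atTop,
      2 * (isingTwoPoint (zdGraph 3) (box 3 n) (criticalBeta 3) 0 .free (Pi.single 0 ((0 : ℕ) : ℤ)) (Pi.single 0 ((a + b : ℕ) : ℤ)) *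
            isingTwoPoint (zdGraph 3) (box 3 n) (criticalBeta 3) 0 .free (Pi.single 0 ((a : ℕ) : ℤ)) (Pi.single 0 ((a + b + c : ℕ) : ℤ))) ^ 2 *
          meanScreening n n (Pi.single 0 ((0 : ℕ) : ℤ)) (Pi.single 0 ((a + b : ℕ) : ℤ)) (Pi.single 0 ((a : ℕ) : ℤ)) (Pi.single 0 ((a + b + c : ℕ) : ℤ)) ≤
        (isingTwoPoint (zdGraph 3) (box 3 n) (criticalBeta 3) 0 .free (Pi.single 0 ((0 : ℕ) : ℤ)) (Pi.single 0 ((a : ℕ) : ℤ)) *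
            isingTwoPoint (zdGraph 3) (box 3 n) (criticalBeta 3) 0 .free (Pi.single 0 ((a + b : ℕ) : ℤ)) (Pi.single 0 ((a + b + c : ℕ) : ℤ)) -
          isingTwoPoint (zdGraph 3) (box 3 n) (criticalBeta 3) 0 .free (Pi.single 0 ((0 : ℕ) : ℤ)) (Pi.single 0 ((a + b : ℕ) : ℤ)) *
            isingTwoPoint (zdGraph 3) (box 3 n) (criticalBeta 3) 0 .free (Pi.single 0 ((a : ℕ) : ℤ)) (Pi.single 0 ((a + b + c : ℕ) : ℤ))) *
          (isingTwoPoint (zdGraph 3) (box 3 n) (criticalBeta 3) 0 .free (Pi.single 0 ((0 : ℕ) : ℤ)) (Pi.single 0 ((a + b + c : ℕ) : ℤ)) *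
            isingTwoPoint (zdGraph 3) (box 3 n) (criticalBeta 3) 0 .free (Pi.single 0 ((a : ℕ) : ℤ)) (Pi.single 0 ((a + b : ℕ) : ℤ)) -
            isingTwoPoint (zdGraph 3) (box 3 n) (criticalBeta 3) 0 .free (Pi.single 0 ((0 : ℕ) : ℤ)) (Pi.single 0 ((a + b : ℕ) : ℤ)) *
            isingTwoPoint (zdGraph 3) (box 3 n) (criticalBeta 3) 0 .free (Pi.single 0 ((a : ℕ) : ℤ)) (Pi.single 0 ((a + b + c : ℕ) : ℤ))) := by
  sorry

/-! ### The composition: the two stubs (+ landed tree theorems) give the crux BY NAME -/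

/-- **The skeleton theorem `Interlacing_of`** — the crux BY NAME from the two declared stubs (the shape
`ledger skeleton check` audits: conclusion = the route decl by name, no hypotheses, every `sorry` inside a `stub_*`).
Real proof: Lebowitz corner by the landed `stub_lebowitzRegime` (through the axis dictionary `stub_axisPair`); window by
`stub_cageScreening` (fed with the landed `stub_monotone`, `stub_logConvex`) + `stub_defectIdentity` in the box
(`linarith`), then the landed box limit `stub_boxLimit`. The hypothesis form
`stub_defectIdentity-sig → stub_cageScreening-sig → Interlacing` is the sorry-free `example` right below (an `example`,
so that the audit sees exactly ONE theorem concluding the crux by name). -/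
theorem Interlacing_of : Interlacing := by
  intro a b c ha hb hc
  -- the six infinite-volume pair correlators through the axis dictionary
  have h0a := stub_axisPair 0 a (Nat.zero_le _)
  have h0ab := stub_axisPair 0 (a + b) (Nat.zero_le _)
  have h0abc := stub_axisPair 0 (a + b + c) (Nat.zero_le _)
  have haabc := stub_axisPair a (a + b + c) (by omega)
  have habab := stub_axisPair (a + b) (a + b + c) (by omega)
  have haab := stub_axisPair a (a + b) (by omega)
  rw [Nat.sub_zero] at h0a h0ab h0abc
  rw [show a + b + c - a = b + c by omega] at haabc
  rw [show a + b + c - (a + b) = c by omega] at habab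
  rw [show a + b - a = b by omega] at haab
  by_cases hwin :
    (criticalTwoPoint 3 (Pi.single 0 ((a : ℕ) : ℤ)) * criticalTwoPoint 3 (Pi.single 0 ((c : ℕ) : ℤ)) -
          criticalTwoPoint 3 (Pi.single 0 ((a + b : ℕ) : ℤ)) * criticalTwoPoint 3 (Pi.single 0 ((b + c : ℕ) : ℤ))) *
        (criticalTwoPoint 3 (Pi.single 0 ((a + b + c : ℕ) : ℤ)) * criticalTwoPoint 3 (Pi.single 0 ((b : ℕ) : ℤ)) -
          criticalTwoPoint 3 (Pi.single 0 ((a + b : ℕ) : ℤ)) * criticalTwoPoint 3 (Pi.single 0 ((b + c : ℕ) : ℤ))) <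
      2 * (criticalTwoPoint 3 (Pi.single 0 ((a + b : ℕ) : ℤ)) * criticalTwoPoint 3 (Pi.single 0 ((b + c : ℕ) : ℤ))) ^ 2
  · -- the window: cage screening level + defect identity give box SPC eventually; then the box limit
    have hev := stub_cageScreening a b c ha hb hc (stub_monotone a b c) (stub_logConvex a b c) hwin
    refine stub_boxLimit a b c ?_
    filter_upwards [hev, eventually_ge_atTop (a + b + c)] with n hn hnabc
    have hid := stub_defectIdentity n a b c hnabc
    linarith [hid, hn]
  · -- the Lebowitz corner (landed)
    have hcorner := le_of_not_gt hwin
    refine stub_lebowitzRegime a b c ?_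
    rw [h0a, h0ab, h0abc, haabc, habab, haab]
    exact hcorner

-- Hypothesis form of the composition, SORRY-FREE and independent of the stubs (the binders shadow the stub names, so the
-- proof text is literally the one above): `(stub_defectIdentity-signature) → (stub_cageScreening-signature) → Interlacing`.
example
    (stub_defectIdentity : ∀ n a b c : ℕ, a + b + c ≤ n →
      isingExpect (zdGraph 3) (box 3 n) (criticalBeta 3) 0 .free (spinMonomial ![(Pi.single 0 ((0 : ℕ) : ℤ)), (Pi.single 0 ((a : ℕ) : ℤ)), (Pi.single 0 ((a + b : ℕ) : ℤ)), (Pi.single 0 ((a + b + c : ℕ) : ℤ))]) *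
          (isingTwoPoint (zdGraph 3) (box 3 n) (criticalBeta 3) 0 .free (Pi.single 0 ((0 : ℕ) : ℤ)) (Pi.single 0 ((a + b : ℕ) : ℤ)) *
            isingTwoPoint (zdGraph 3) (box 3 n) (criticalBeta 3) 0 .free (Pi.single 0 ((a : ℕ) : ℤ)) (Pi.single 0 ((a + b + c : ℕ) : ℤ))) -
        isingTwoPoint (zdGraph 3) (box 3 n) (criticalBeta 3) 0 .free (Pi.single 0 ((0 : ℕ) : ℤ)) (Pi.single 0 ((a : ℕ) : ℤ)) *
            isingTwoPoint (zdGraph 3) (box 3 n) (criticalBeta 3) 0 .free (Pi.single 0 ((a + b : ℕ) : ℤ)) (Pi.single 0 ((a + b + c : ℕ) : ℤ)) *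
          (isingTwoPoint (zdGraph 3) (box 3 n) (criticalBeta 3) 0 .free (Pi.single 0 ((0 : ℕ) : ℤ)) (Pi.single 0 ((a + b + c : ℕ) : ℤ)) *
            isingTwoPoint (zdGraph 3) (box 3 n) (criticalBeta 3) 0 .free (Pi.single 0 ((a : ℕ) : ℤ)) (Pi.single 0 ((a + b : ℕ) : ℤ))) =
      2 * (isingTwoPoint (zdGraph 3) (box 3 n) (criticalBeta 3) 0 .free (Pi.single 0 ((0 : ℕ) : ℤ)) (Pi.single 0 ((a + b : ℕ) : ℤ)) *
            isingTwoPoint (zdGraph 3) (box 3 n) (criticalBeta 3) 0 .free (Pi.single 0 ((a : ℕ) : ℤ)) (Pi.single 0 ((a + b + c : ℕ) : ℤ))) ^ 2 *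
          meanScreening n n (Pi.single 0 ((0 : ℕ) : ℤ)) (Pi.single 0 ((a + b : ℕ) : ℤ)) (Pi.single 0 ((a : ℕ) : ℤ)) (Pi.single 0 ((a + b + c : ℕ) : ℤ)) -
        (isingTwoPoint (zdGraph 3) (box 3 n) (criticalBeta 3) 0 .free (Pi.single 0 ((0 : ℕ) : ℤ)) (Pi.single 0 ((a : ℕ) : ℤ)) *
            isingTwoPoint (zdGraph 3) (box 3 n) (criticalBeta 3) 0 .free (Pi.single 0 ((a + b : ℕ) : ℤ)) (Pi.single 0 ((a + b + c : ℕ) : ℤ)) -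
          isingTwoPoint (zdGraph 3) (box 3 n) (criticalBeta 3) 0 .free (Pi.single 0 ((0 : ℕ) : ℤ)) (Pi.single 0 ((a + b : ℕ) : ℤ)) *
            isingTwoPoint (zdGraph 3) (box 3 n) (criticalBeta 3) 0 .free (Pi.single 0 ((a : ℕ) : ℤ)) (Pi.single 0 ((a + b + c : ℕ) : ℤ))) *
          (isingTwoPoint (zdGraph 3) (box 3 n) (criticalBeta 3) 0 .free (Pi.single 0 ((0 : ℕ) : ℤ)) (Pi.single 0 ((a + b + c : ℕ) : ℤ)) *
            isingTwoPoint (zdGraph 3) (box 3 n) (criticalBeta 3) 0 .free (Pi.single 0 ((a : ℕ) : ℤ)) (Pi.single 0 ((a + b : ℕ) : ℤ)) -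
            isingTwoPoint (zdGraph 3) (box 3 n) (criticalBeta 3) 0 .free (Pi.single 0 ((0 : ℕ) : ℤ)) (Pi.single 0 ((a + b : ℕ) : ℤ)) *
            isingTwoPoint (zdGraph 3) (box 3 n) (criticalBeta 3) 0 .free (Pi.single 0 ((a : ℕ) : ℤ)) (Pi.single 0 ((a + b + c : ℕ) : ℤ))))
    (stub_cageScreening : ∀ a b c : ℕ, 1 ≤ a → 1 ≤ b → 1 ≤ c →
      criticalTwoPoint 3 (Pi.single 0 ((a + b : ℕ) : ℤ)) * criticalTwoPoint 3 (Pi.single 0 ((b + c : ℕ) : ℤ)) ≤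
      criticalTwoPoint 3 (Pi.single 0 ((a : ℕ) : ℤ)) * criticalTwoPoint 3 (Pi.single 0 ((c : ℕ) : ℤ)) →
      criticalTwoPoint 3 (Pi.single 0 ((a + b : ℕ) : ℤ)) * criticalTwoPoint 3 (Pi.single 0 ((b + c : ℕ) : ℤ)) ≤
      criticalTwoPoint 3 (Pi.single 0 ((a + b + c : ℕ) : ℤ)) * criticalTwoPoint 3 (Pi.single 0 ((b : ℕ) : ℤ)) →
      (criticalTwoPoint 3 (Pi.single 0 ((a : ℕ) : ℤ)) * criticalTwoPoint 3 (Pi.single 0 ((c : ℕ) : ℤ)) -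
          criticalTwoPoint 3 (Pi.single 0 ((a + b : ℕ) : ℤ)) * criticalTwoPoint 3 (Pi.single 0 ((b + c : ℕ) : ℤ))) *
        (criticalTwoPoint 3 (Pi.single 0 ((a + b + c : ℕ) : ℤ)) * criticalTwoPoint 3 (Pi.single 0 ((b : ℕ) : ℤ)) -
          criticalTwoPoint 3 (Pi.single 0 ((a + b : ℕ) : ℤ)) * criticalTwoPoint 3 (Pi.single 0 ((b + c : ℕ) : ℤ))) <
      2 * (criticalTwoPoint 3 (Pi.single 0 ((a + b : ℕ) : ℤ)) * criticalTwoPoint 3 (Pi.single 0 ((b + c : ℕ) : ℤ))) ^ 2 →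
      ∀ᶠ n : ℕ in atTop,
        2 * (isingTwoPoint (zdGraph 3) (box 3 n) (criticalBeta 3) 0 .free (Pi.single 0 ((0 : ℕ) : ℤ)) (Pi.single 0 ((a + b : ℕ) : ℤ)) *
            isingTwoPoint (zdGraph 3) (box 3 n) (criticalBeta 3) 0 .free (Pi.single 0 ((a : ℕ) : ℤ)) (Pi.single 0 ((a + b + c : ℕ) : ℤ))) ^ 2 *
          meanScreening n n (Pi.single 0 ((0 : ℕ) : ℤ)) (Pi.single 0 ((a + b : ℕ) : ℤ)) (Pi.single 0 ((a : ℕ) : ℤ)) (Pi.single 0 ((a + b + c : ℕ) : ℤ)) ≤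
        (isingTwoPoint (zdGraph 3) (box 3 n) (criticalBeta 3) 0 .free (Pi.single 0 ((0 : ℕ) : ℤ)) (Pi.single 0 ((a : ℕ) : ℤ)) *
            isingTwoPoint (zdGraph 3) (box 3 n) (criticalBeta 3) 0 .free (Pi.single 0 ((a + b : ℕ) : ℤ)) (Pi.single 0 ((a + b + c : ℕ) : ℤ)) -
          isingTwoPoint (zdGraph 3) (box 3 n) (criticalBeta 3) 0 .free (Pi.single 0 ((0 : ℕ) : ℤ)) (Pi.single 0 ((a + b : ℕ) : ℤ)) *
            isingTwoPoint (zdGraph 3) (box 3 n) (criticalBeta 3) 0 .free (Pi.single 0 ((a : ℕ) : ℤ)) (Pi.single 0 ((a + b + c : ℕ) : ℤ))) *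
          (isingTwoPoint (zdGraph 3) (box 3 n) (criticalBeta 3) 0 .free (Pi.single 0 ((0 : ℕ) : ℤ)) (Pi.single 0 ((a + b + c : ℕ) : ℤ)) *
            isingTwoPoint (zdGraph 3) (box 3 n) (criticalBeta 3) 0 .free (Pi.single 0 ((a : ℕ) : ℤ)) (Pi.single 0 ((a + b : ℕ) : ℤ)) -
            isingTwoPoint (zdGraph 3) (box 3 n) (criticalBeta 3) 0 .free (Pi.single 0 ((0 : ℕ) : ℤ)) (Pi.single 0 ((a + b : ℕ) : ℤ)) *
            isingTwoPoint (zdGraph 3) (box 3 n) (criticalBeta 3) 0 .free (Pi.single 0 ((a : ℕ) : ℤ)) (Pi.single 0 ((a + b + c : ℕ) : ℤ)))) :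
    Interlacing := by
  intro a b c ha hb hc
  -- the six infinite-volume pair correlators through the axis dictionary
  have h0a := stub_axisPair 0 a (Nat.zero_le _)
  have h0ab := stub_axisPair 0 (a + b) (Nat.zero_le _)
  have h0abc := stub_axisPair 0 (a + b + c) (Nat.zero_le _)
  have haabc := stub_axisPair a (a + b + c) (by omega)
  have habab := stub_axisPair (a + b) (a + b + c) (by omega)
  have haab := stub_axisPair a (a + b) (by omega)
  rw [Nat.sub_zero] at h0a h0ab h0abc
  rw [show a + b + c - a = b + c by omega] at haabc
  rw [show a + b + c - (a + b) = c by omega] at habab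
  rw [show a + b - a = b by omega] at haab
  by_cases hwin :
    (criticalTwoPoint 3 (Pi.single 0 ((a : ℕ) : ℤ)) * criticalTwoPoint 3 (Pi.single 0 ((c : ℕ) : ℤ)) -
          criticalTwoPoint 3 (Pi.single 0 ((a + b : ℕ) : ℤ)) * criticalTwoPoint 3 (Pi.single 0 ((b + c : ℕ) : ℤ))) *
        (criticalTwoPoint 3 (Pi.single 0 ((a + b + c : ℕ) : ℤ)) * criticalTwoPoint 3 (Pi.single 0 ((b : ℕ) : ℤ)) -
          criticalTwoPoint 3 (Pi.single 0 ((a + b : ℕ) : ℤ)) * criticalTwoPoint 3 (Pi.single 0 ((b + c : ℕ) : ℤ))) <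
      2 * (criticalTwoPoint 3 (Pi.single 0 ((a + b : ℕ) : ℤ)) * criticalTwoPoint 3 (Pi.single 0 ((b + c : ℕ) : ℤ))) ^ 2
  · -- the window: cage screening level + defect identity give box SPC eventually; then the box limit
    have hev := stub_cageScreening a b c ha hb hc (stub_monotone a b c) (stub_logConvex a b c) hwin
    refine stub_boxLimit a b c ?_
    filter_upwards [hev, eventually_ge_atTop (a + b + c)] with n hn hnabc
    have hid := stub_defectIdentity n a b c hnabc
    linarith [hid, hn]
  · -- the Lebowitz corner (landed)
    have hcorner := le_of_not_gt hwin
    refine stub_lebowitzRegime a b c ?_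
    rw [h0a, h0ab, h0abc, haabc, habab, haab]
    exact hcorner

end Summit.CriticalPhenomena.Ising3DConformalLimit.Cruxes.Interlacing.Birth

end
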